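import Summits.ABC.ABC.Theses.CubicResolventAllowance
import Literature.NumberTheory.CubicFields.CubicFieldSignatureFromDiscriminant
import Mathlib.NumberTheory.NumberField.Units.DirichletTheorem
import HarnessLib

/-!
# STUB-IDEAS `stub_realCubic` · ideator k2 (HOME FAMILY 2 — RESHAPE) · generation 14 — companion sketch

Crux `stmt-ABC-22740` (`CubicResolventAllowance.IndexSzpiro`), stub `stub_realCubic` (the `0 < d_K` half).
Plan text: `Cruxes/IndexSzpiro/STUB-IDEAS-stub_realCubic-2.md` (gen 14).

What is typed here (statements + short proofs; NO `sorry`):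
* §0 `StubRealCubic` — the registered stub, verbatim.
* §1 D1 `StubTotallyReal`, `stubRealCubic_iff_stubTotallyReal` — the stub in Mathlib's native currency
  (`NumberField.IsTotallyReal K` instead of `0 < discr K`; Brill for cubics, tree lemma
  `Literature.NumberTheory.CubicFields.isTotallyReal_iff_discr_pos_of_finrank_eq_three`).
* §2 D2 `card_infinitePlace_eq_three`, `units_rank_eq_two` / `units_rank_eq_one_of_discr_neg` — the
  dictionary of the homogeneous-dynamics reformulation (gen-14 cell T1): on the real class the diagonal torus
  acting on the Minkowski lattice of `𝓞_K` has rank `2` (three real places, unit rank `2`), on the complex twin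
  rank `1` — the one place in modern mathematics where `0 < d_K` is a hypothesis with teeth (EKL / ELMV need
  rank ≥ 2), and the reason the skeleton's sign split could matter at all.
* §3 D3 `StubNotTotallyReal`, `indexSzpiro_iff_totallyReal_split` — the skeleton's two stubs are ONE statement
  split on `IsTotallyReal K` (merge recommendation; cf. k2-g7 `R1`).
-/

set_option linter.dupNamespace false

noncomputable section

namespace Summit.ABC.ABC.Cruxes.IndexSzpiro.StubIdeas2RealG14

open Summit.ABC.ABC.Theses.CubicResolventAllowance Polynomial NumberField NumberField.InfinitePlace Module
open Literature.NumberTheory.CubicFields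

/-! ## §0 The stub, verbatim -/

/-- `stub_realCubic` (verbatim signature of the registered stub). -/
def StubRealCubic : Prop :=
  ∀ ε : ℝ, 0 < ε → ∃ C : ℝ, ∀ (W : WeierstrassCurve ℚ) [W.IsElliptic] (K : Type) [Field K] [NumberField K],
    Irreducible W.twoTorsionPolynomial.toPoly → Module.finrank ℚ K = 3 →
    (∃ θ : K, aeval θ W.twoTorsionPolynomial.toPoly = 0) → 0 < NumberField.discr K →
    (W.minimalDiscriminantNorm ℤ : ℝ) ≤ C * |(NumberField.discr K : ℝ)| * (W.conductorNorm ℤ : ℝ) ^ (6 + ε)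

/-! ## §1 D1 — the stub over `IsTotallyReal` -/

/-- **D1.** The stub with the sign hypothesis replaced by `IsTotallyReal K` — the form every totally-real
engine consumes (Shimura-curve parametrisations over totally real fields, k2-g8 §I; periodic rank-2 torus
orbits, gen-14 T1). -/
def StubTotallyReal : Prop :=
  ∀ ε : ℝ, 0 < ε → ∃ C : ℝ, ∀ (W : WeierstrassCurve ℚ) [W.IsElliptic] (K : Type) [Field K] [NumberField K],
    Irreducible W.twoTorsionPolynomial.toPoly → Module.finrank ℚ K = 3 →
    (∃ θ : K, aeval θ W.twoTorsionPolynomial.toPoly = 0) → IsTotallyReal K →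
    (W.minimalDiscriminantNorm ℤ : ℝ) ≤ C * |(NumberField.discr K : ℝ)| * (W.conductorNorm ℤ : ℝ) ^ (6 + ε)

/-- **D1 (S, PROVED).** `stub_realCubic ↔ StubTotallyReal` — Brill for cubics (`sign d_K = (−1)^{r₂}`, `r₂ ∈ {0,1}`).
[cite: Cohen1993, Prop. 4.8.11] -/
theorem stubRealCubic_iff_stubTotallyReal : StubRealCubic ↔ StubTotallyReal := by
  constructor
  · intro h ε hε
    obtain ⟨C, hC⟩ := h ε hε
    exact ⟨C, fun W _ K _ _ hirr hK hθ hT =>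
      hC W K hirr hK hθ ((isTotallyReal_iff_discr_pos_of_finrank_eq_three K hK).mp hT)⟩
  · intro h ε hε
    obtain ⟨C, hC⟩ := h ε hε
    exact ⟨C, fun W _ K _ _ hirr hK hθ hd =>
      hC W K hirr hK hθ ((isTotallyReal_iff_discr_pos_of_finrank_eq_three K hK).mpr hd)⟩

/-! ## §2 D2 — the rank of the acting torus (dictionary of the dynamical reformulation) -/

/-- **D2a (XS, PROVED).** On the real class `K` has exactly three (real) infinite places. -/
theorem card_infinitePlace_eq_three (K : Type) [Field K] [NumberField K] (hK : finrank ℚ K = 3)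
    (hd : 0 < NumberField.discr K) : Fintype.card (InfinitePlace K) = 3 := by
  haveI : IsTotallyReal K := (isTotallyReal_iff_discr_pos_of_finrank_eq_three K hK).mpr hd
  rw [card_eq_nrRealPlaces_add_nrComplexPlaces, IsTotallyReal.nrComplexPlaces_eq_zero, add_zero,
    ← IsTotallyReal.finrank, hK]

/-- **D2b (XS, PROVED).** Unit rank `2` on the real class: the split torus `A ≅ (ℝ_{>0})²` of `SL₃(ℝ)` stabilising
the Minkowski lattice of `𝓞_K` acts with a PERIODIC (compact) orbit of rank `2` — the EKL/ELMV regime. -/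
theorem units_rank_eq_two (K : Type) [Field K] [NumberField K] (hK : finrank ℚ K = 3)
    (hd : 0 < NumberField.discr K) : NumberField.Units.rank K = 2 := by
  rw [NumberField.Units.rank, card_infinitePlace_eq_three K hK hd]

/-- **D2c (XS, PROVED).** The complex twin has unit rank `1` (one real, one complex place): a rank-ONE torus,
where no measure-rigidity phenomenon exists. -/
theorem units_rank_eq_one_of_discr_neg (K : Type) [Field K] [NumberField K] (hK : finrank ℚ K = 3)
    (hd : NumberField.discr K < 0) : NumberField.Units.rank K = 1 := by
  have h1 : nrRealPlaces K = 1 := (nrRealPlaces_eq_one_iff_discr_neg_of_finrank_eq_three K hK).mpr hd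
  have h := card_add_two_mul_card_eq_rank K
  rw [hK, h1] at h
  have h2 : nrComplexPlaces K = 1 := by omega
  rw [NumberField.Units.rank, card_eq_nrRealPlaces_add_nrComplexPlaces, h1, h2]

/-! ## §3 D3 — the skeleton's two stubs are one statement split on `IsTotallyReal` -/

/-- The complex twin over `¬ IsTotallyReal K` (`↔ discr K < 0`, tree lemma
`not_isTotallyReal_iff_discr_neg_of_finrank_eq_three`; = `stub_complexCubic` modulo Brill). -/
def StubNotTotallyReal : Prop :=
  ∀ ε : ℝ, 0 < ε → ∃ C : ℝ, ∀ (W : WeierstrassCurve ℚ) [W.IsElliptic] (K : Type) [Field K] [NumberField K],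
    Irreducible W.twoTorsionPolynomial.toPoly → Module.finrank ℚ K = 3 →
    (∃ θ : K, aeval θ W.twoTorsionPolynomial.toPoly = 0) → ¬ IsTotallyReal K →
    (W.minimalDiscriminantNorm ℤ : ℝ) ≤ C * |(NumberField.discr K : ℝ)| * (W.conductorNorm ℤ : ℝ) ^ (6 + ε)

/-- **D3 (S, PROVED).** The route crux, BY NAME, is the conjunction of the two signature halves; the split costs
nothing and — gen-14 T1 verdict — buys nothing either: MERGE the sign stubs. -/
theorem indexSzpiro_iff_totallyReal_split : IndexSzpiro ↔ StubTotallyReal ∧ StubNotTotallyReal := by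
  constructor
  · intro h
    refine ⟨fun ε hε => ?_, fun ε hε => ?_⟩
    · obtain ⟨C, hC⟩ := h ε hε
      exact ⟨C, fun W _ K _ _ hirr hK hθ _ => hC W K hirr hK hθ⟩
    · obtain ⟨C, hC⟩ := h ε hε
      exact ⟨C, fun W _ K _ _ hirr hK hθ _ => hC W K hirr hK hθ⟩
  · rintro ⟨h₁, h₂⟩ ε hε
    obtain ⟨C₁, hC₁⟩ := h₁ ε hε
    obtain ⟨C₂, hC₂⟩ := h₂ ε hε
    refine ⟨max C₁ C₂, fun W _ K _ _ hirr hK hθ => ?_⟩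
    have hN : (0 : ℝ) ≤ |(NumberField.discr K : ℝ)| * (W.conductorNorm ℤ : ℝ) ^ (6 + ε) :=
      mul_nonneg (abs_nonneg _) (Real.rpow_nonneg (Nat.cast_nonneg _) _)
    by_cases hT : IsTotallyReal K
    · calc (W.minimalDiscriminantNorm ℤ : ℝ)
          ≤ C₁ * |(NumberField.discr K : ℝ)| * (W.conductorNorm ℤ : ℝ) ^ (6 + ε) := hC₁ W K hirr hK hθ hT
        _ ≤ max C₁ C₂ * |(NumberField.discr K : ℝ)| * (W.conductorNorm ℤ : ℝ) ^ (6 + ε) := by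
          rw [mul_assoc, mul_assoc]; exact mul_le_mul_of_nonneg_right (le_max_left _ _) hN
    · calc (W.minimalDiscriminantNorm ℤ : ℝ)
          ≤ C₂ * |(NumberField.discr K : ℝ)| * (W.conductorNorm ℤ : ℝ) ^ (6 + ε) := hC₂ W K hirr hK hθ hT
        _ ≤ max C₁ C₂ * |(NumberField.discr K : ℝ)| * (W.conductorNorm ℤ : ℝ) ^ (6 + ε) := by
          rw [mul_assoc, mul_assoc]; exact mul_le_mul_of_nonneg_right (le_max_right _ _) hN

end Summit.ABC.ABC.Cruxes.IndexSzpiro.StubIdeas2RealG14
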